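import Mathlib
import Literature.Probability.LatticeModels.ThermodynamicLimit
import Literature.MathematicalPhysics.QuantumLattice.LatticeScalarField
import Literature.Barriers.CriticalPhenomena.RigorousRGSmallParameterRiemannSum

/-!
# Route `UniversalDetector`, support item `LimitExtraction` (stmt-QuantumFields-26597): continuum limit of lattice Riemann sums

Ideator seat ym-idea-8 g4.  Measure-theoretic core of the `Q2`-convergence conjunct of `LimitExtraction`
(`Q2 = Σ_{x,y ∈ box 4 L_k} w₁(a_k x) w₂(a_k y) Cov_k(x,y) → ∫∫ w₁(x) w₂(y) K(y-x)` along `a_k → 0`, `a_k L_k → ∞`),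
free of lattice gauge theory: for continuous `Ψ` with (product-)polynomial decay of order `p > d`, `0 < s_k → 0`, `s_k L_k → ∞`,
* `tendsto_latticeRiemannSum`  — `s_k^d Σ_{x ∈ box d L_k} Ψ(s_k x) → ∫ Ψ`;
* `tendsto_latticeRiemannSum₂` — `s_k^{2d} Σ_{x,x' ∈ box d L_k} Ψ(s_k x, s_k x') → ∫_{ℝ^d × ℝ^d} Ψ` (the shape of `Q2`,
  `d = 4`, `Ψ(u,v) = w₁(u) w₂(v) K(v-u)`).
Method: the lattice sum is the integral of the step function constant on the cells of `s_k ℤ^d` (the tree's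
`FRD.cell` API), then dominated convergence on `(Fin d → ℝ)` (resp. its square) with majorant `(1 + ‖y‖)^{-p}`
(`integrable_one_add_norm`), cells shrinking to points (`‖y - s x‖ ≤ √d s`), boxes eventually covering every point,
and transport to `EuclideanSpace` by the volume-preserving `toLp`.  Companion uniform bounds:
`UniversalDetectorLatticeRiemannBounds`.  No summit, leg or spine statement is proved here.
-/

set_option autoImplicit false

namespace Summit.QuantumFields.YangMills.Cruxes.UniversalDetectorLimitExtraction

open Finset MeasureTheory Filter Topology Literature.Probability.LatticeModels
  Literature.MathematicalPhysics.QuantumLattice Literature.Barriers.CriticalPhenomena.LongRangePhi4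

/-! ### Part A: the cell step function of a lattice sum -/

/-- Evaluation of the cell step function: on the cell of `x` it takes the value `c x` (if `x ∈ B`), else `0`. -/
private lemma cellStep_apply {d : ℕ} {s : ℝ} (hs : 0 < s) (B : Finset (Site d)) (c : Site d → ℝ)
    (y : Fin d → ℝ) :
    ∑ x ∈ B, (FRD.cell s⁻¹ x).indicator (fun _ => c x) y =
      if (fun i => ⌊s⁻¹ * y i⌋) ∈ B then c (fun i => ⌊s⁻¹ * y i⌋) else 0 := by
  have hΛ : 0 < s⁻¹ := inv_pos.2 hs
  have hy : y ∈ FRD.cell s⁻¹ (fun i => ⌊s⁻¹ * y i⌋) := FRD.mem_cell_floor hΛ y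
  have hne : ∀ x : Site d, x ≠ (fun i => ⌊s⁻¹ * y i⌋) → y ∉ FRD.cell s⁻¹ x :=
    fun x hx hyx => hx (FRD.eq_floor_of_mem_cell hΛ hyx)
  split_ifs with h
  · rw [sum_eq_single_of_mem _ h (fun x _ hx => Set.indicator_of_notMem (hne x hx) _),
      Set.indicator_of_mem hy]
  · refine sum_eq_zero fun x hx => Set.indicator_of_notMem (fun hyx => h ?_) _
    rw [← FRD.eq_floor_of_mem_cell hΛ hyx]; exact hx

/-- The integral of the cell step function is the normalised lattice sum `s^d Σ_{x ∈ B} c x`. -/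
private lemma integral_cellStep {d : ℕ} {s : ℝ} (hs : 0 < s) (B : Finset (Site d)) (c : Site d → ℝ) :
    ∫ y, ∑ x ∈ B, (FRD.cell s⁻¹ x).indicator (fun _ => c x) y = s ^ d * ∑ x ∈ B, c x := by
  have hΛ : 0 < s⁻¹ := inv_pos.2 hs
  have hint : ∀ x ∈ B, Integrable ((FRD.cell s⁻¹ x).indicator (fun _ : Fin d → ℝ => c x)) := by
    intro x _
    refine (integrableOn_const ?_).integrable_indicator (FRD.measurableSet_cell _ x)
    rw [FRD.volume_cell hΛ]; exact ENNReal.ofReal_ne_top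
  rw [integral_finsetSum _ hint, mul_sum]
  refine sum_congr rfl fun x _ => ?_
  rw [integral_indicator_const (c x) (FRD.measurableSet_cell _ x), FRD.volume_real_cell hΛ, smul_eq_mul,
    inv_pow, inv_inv]

/-! ### Part B: cells in the Euclidean norm -/

/-- A coordinate is bounded by the Euclidean norm. -/
private lemma abs_apply_le_norm' {d : ℕ} (u : EuclideanSpace ℝ (Fin d)) (i : Fin d) : |u i| ≤ ‖u‖ := by
  rw [EuclideanSpace.norm_eq, ← Real.sqrt_sq_eq_abs]
  refine Real.sqrt_le_sqrt (Finset.single_le_sum (f := fun j => ‖u j‖ ^ 2) (fun j _ => by positivity)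
    (Finset.mem_univ i) |>.trans_eq' ?_)
  simp [Real.norm_eq_abs]

/-- The sup norm of the coordinates is bounded by the Euclidean norm. -/
private lemma pi_norm_le_norm_toLp {d : ℕ} (y : Fin d → ℝ) :
    ‖y‖ ≤ ‖(WithLp.toLp 2 y : EuclideanSpace ℝ (Fin d))‖ := by
  refine (pi_norm_le_iff_of_nonneg (norm_nonneg _)).2 fun i => ?_
  rw [Real.norm_eq_abs]
  simpa using abs_apply_le_norm' (WithLp.toLp 2 y : EuclideanSpace ℝ (Fin d)) i

/-- The Euclidean norm is at most `√d` times the sup norm. -/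
private lemma norm_toLp_le {d : ℕ} (v : Fin d → ℝ) :
    ‖(WithLp.toLp 2 v : EuclideanSpace ℝ (Fin d))‖ ≤ Real.sqrt d * ‖v‖ := by
  rw [EuclideanSpace.norm_eq]
  have h : ∑ i : Fin d, ‖(WithLp.toLp 2 v : EuclideanSpace ℝ (Fin d)) i‖ ^ 2 ≤ (d : ℝ) * ‖v‖ ^ 2 := by
    calc ∑ i : Fin d, ‖(WithLp.toLp 2 v : EuclideanSpace ℝ (Fin d)) i‖ ^ 2 ≤ ∑ _i : Fin d, ‖v‖ ^ 2 := by
          refine sum_le_sum fun i _ => ?_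
          gcongr
          simpa using norm_le_pi_norm v i
      _ = (d : ℝ) * ‖v‖ ^ 2 := by rw [sum_const, card_univ, Fintype.card_fin, nsmul_eq_mul]
  calc Real.sqrt (∑ i : Fin d, ‖(WithLp.toLp 2 v : EuclideanSpace ℝ (Fin d)) i‖ ^ 2)
      ≤ Real.sqrt ((d : ℝ) * ‖v‖ ^ 2) := Real.sqrt_le_sqrt h
    _ = Real.sqrt d * ‖v‖ := by rw [Real.sqrt_mul (Nat.cast_nonneg d), Real.sqrt_sq (norm_nonneg _)]

/-- A point of the cell of `x` (spacing `s`) is within `√d · s` of the lattice point `s x` in `E`. -/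
private lemma norm_toLp_sub_smul_siteToE_le {d : ℕ} {s : ℝ} (hs : 0 < s) {x : Site d} {y : Fin d → ℝ}
    (hy : y ∈ FRD.cell s⁻¹ x) :
    ‖(WithLp.toLp 2 y : EuclideanSpace ℝ (Fin d)) - s • siteToE x‖ ≤ Real.sqrt d * s := by
  have h1 := FRD.norm_sub_corner_le (inv_pos.2 hs) hy
  rw [inv_inv] at h1
  have h2 : (WithLp.toLp 2 y : EuclideanSpace ℝ (Fin d)) - s • siteToE x =
      WithLp.toLp 2 (y - fun i => (x i : ℝ) / s⁻¹) := by
    ext i; simp [siteToE_apply, div_inv_eq_mul, mul_comm]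
  rw [h2]
  exact (norm_toLp_le _).trans (by gcongr)

/-- Shifting the decay weight by a bounded amount costs a factor `(1 + D)^p`. -/
private lemma inv_pow_le_of_norm_sub_le {E' : Type*} [SeminormedAddCommGroup E'] {u v : E'} {D : ℝ}
    (hD : 0 ≤ D) (h : ‖u - v‖ ≤ D) (p : ℕ) :
    ((1 + ‖v‖) ^ p)⁻¹ ≤ (1 + D) ^ p * ((1 + ‖u‖) ^ p)⁻¹ := by
  have h1 : 1 + ‖u‖ ≤ (1 + D) * (1 + ‖v‖) := by
    have : ‖u‖ ≤ ‖v‖ + D := by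
      calc ‖u‖ = ‖v + (u - v)‖ := by rw [add_sub_cancel]
        _ ≤ ‖v‖ + ‖u - v‖ := norm_add_le _ _
        _ ≤ ‖v‖ + D := by gcongr
    nlinarith [norm_nonneg u, norm_nonneg v]
  have h2 : (1 + ‖u‖) ^ p ≤ ((1 + D) * (1 + ‖v‖)) ^ p := pow_le_pow_left₀ (by positivity) h1 p
  rw [mul_pow] at h2
  rw [← div_eq_mul_inv, le_div_iff₀ (by positivity)]
  calc ((1 + ‖v‖) ^ p)⁻¹ * (1 + ‖u‖) ^ p ≤ ((1 + ‖v‖) ^ p)⁻¹ * ((1 + D) ^ p * (1 + ‖v‖) ^ p) := by gcongr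
    _ = (1 + D) ^ p := by field_simp

/-- For fixed `y`, the lattice point below `y` eventually lies in the box (`s_k ≤ 1`, `s_k L_k → ∞`). -/
private lemma eventually_floor_mem_box {d : ℕ} (s : ℕ → ℝ) (hs : ∀ k, 0 < s k) (hs1 : ∀ k, s k ≤ 1)
    (L : ℕ → ℕ) (hL : Tendsto (fun k => s k * L k) atTop atTop) (y : Fin d → ℝ) :
    ∀ᶠ k in atTop, (fun i => ⌊(s k)⁻¹ * y i⌋ : Site d) ∈ box d (L k) := by
  filter_upwards [hL.eventually_ge_atTop (‖y‖ + 1)] with k hk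
  rw [mem_box]
  intro i
  have hyi : |y i| ≤ ‖y‖ := by simpa [Real.norm_eq_abs] using norm_le_pi_norm y i
  have hsk := hs k
  have hy1 := le_abs_self (y i); have hy2 := neg_abs_le (y i)
  have h1 : (s k)⁻¹ * y i ≤ (L k : ℝ) - 1 := by
    rw [inv_mul_le_iff₀ hsk]; nlinarith [hs1 k]
  have h2 : -((L k : ℝ) - 1) ≤ (s k)⁻¹ * y i := by
    rw [le_inv_mul_iff₀ hsk]; nlinarith [hs1 k]
  exact ⟨by rw [Int.le_floor]; push_cast; linarith, by rw [Int.floor_le_iff]; push_cast; linarith⟩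

/-- For fixed `y`, the lattice points below `y` converge to `y` as the spacing tends to `0`. -/
private lemma tendsto_latticePoint {d : ℕ} (s : ℕ → ℝ) (hs : ∀ k, 0 < s k) (hs0 : Tendsto s atTop (𝓝 0))
    (y : Fin d → ℝ) :
    Tendsto (fun k => s k • siteToE (fun i => ⌊(s k)⁻¹ * y i⌋ : Site d)) atTop
      (𝓝 (WithLp.toLp 2 y : EuclideanSpace ℝ (Fin d))) := by
  rw [tendsto_iff_norm_sub_tendsto_zero]
  have h0 : Tendsto (fun k => Real.sqrt d * s k) atTop (𝓝 0) := by
    simpa using hs0.const_mul (Real.sqrt d)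
  refine squeeze_zero (fun k => norm_nonneg _) (fun k => ?_) h0
  rw [norm_sub_rev]
  exact norm_toLp_sub_smul_siteToE_le (hs k) (FRD.mem_cell_floor (inv_pos.2 (hs k)) y)

/-! ### Part C: the continuum limit of lattice Riemann sums -/

/-- Dominated-convergence core (all spacings `≤ 1`). -/
private lemma tendsto_latticeRiemannSum_aux {d : ℕ} (Ψ : EuclideanSpace ℝ (Fin d) → ℝ) (hΨ : Continuous Ψ)
    {C : ℝ} {p : ℕ} (hp : d < p) (hdom : ∀ u, |Ψ u| ≤ C * ((1 + ‖u‖) ^ p)⁻¹)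
    (s : ℕ → ℝ) (hs : ∀ k, 0 < s k) (hs1 : ∀ k, s k ≤ 1) (hs0 : Tendsto s atTop (𝓝 0))
    (L : ℕ → ℕ) (hL : Tendsto (fun k => s k * L k) atTop atTop) :
    Tendsto (fun k => s k ^ d * ∑ x ∈ box d (L k), Ψ (s k • siteToE x)) atTop (𝓝 (∫ u, Ψ u)) := by
  have hC : 0 ≤ C := by
    have h := hdom 0; simp only [norm_zero, add_zero, one_pow, inv_one, mul_one] at h; exact (abs_nonneg _).trans h
  -- the step functions and the limit function on the coordinate space `Fin d → ℝ`
  set F : ℕ → (Fin d → ℝ) → ℝ := fun k y =>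
    ∑ x ∈ box d (L k), (FRD.cell (s k)⁻¹ x).indicator (fun _ => Ψ (s k • siteToE x)) y with hF
  set f : (Fin d → ℝ) → ℝ := fun y => Ψ (WithLp.toLp 2 y) with hf
  -- (1) integrals of the step functions are the Riemann sums
  have hI : ∀ k, ∫ y, F k y = s k ^ d * ∑ x ∈ box d (L k), Ψ (s k • siteToE x) := fun k =>
    integral_cellStep (hs k) _ _
  -- (2) the limit integral, transported to `E`
  have hmp : MeasurePreserving (⇑(MeasurableEquiv.toLp 2 (Fin d → ℝ))) volume volume := by
    rw [MeasurableEquiv.coe_toLp]; exact PiLp.volume_preserving_toLp (Fin d)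
  have hJ : ∫ y, f y = ∫ u, Ψ u := by
    have h := hmp.integral_comp' (g := Ψ)
    simpa [hf, MeasurableEquiv.coe_toLp] using h
  -- (3) dominated convergence
  have hlim : Tendsto (fun k => ∫ y, F k y) atTop (𝓝 (∫ y, f y)) := by
    refine tendsto_integral_of_dominated_convergence
      (fun y => C * (1 + Real.sqrt d) ^ p * ((1 + ‖y‖) ^ p)⁻¹) ?_ ?_ ?_ ?_
    · intro k
      show AEStronglyMeasurable (fun y => ∑ x ∈ box d (L k),
        (FRD.cell (s k)⁻¹ x).indicator (fun _ => Ψ (s k • siteToE x)) y) volume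
      exact Finset.aestronglyMeasurable_fun_sum _ fun x _ =>
        (aestronglyMeasurable_const (b := Ψ (s k • siteToE x))).indicator (FRD.measurableSet_cell _ x)
    · have hfr : (Module.finrank ℝ (Fin d → ℝ) : ℝ) < (p : ℝ) := by
        rw [Module.finrank_fintype_fun_eq_card, Fintype.card_fin]; exact_mod_cast hp
      have h := (integrable_one_add_norm (E := Fin d → ℝ) (μ := volume) hfr).const_mul
        (C * (1 + Real.sqrt d) ^ p)
      refine h.congr (Filter.Eventually.of_forall fun y => ?_)
      simp only
      rw [Real.rpow_neg (by positivity), Real.rpow_natCast]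
    · intro k
      refine Filter.Eventually.of_forall fun y => ?_
      rw [Real.norm_eq_abs, hF]
      simp only
      rw [cellStep_apply (hs k)]
      split_ifs with hmem
      · have hy : y ∈ FRD.cell (s k)⁻¹ (fun i => ⌊(s k)⁻¹ * y i⌋) := FRD.mem_cell_floor (inv_pos.2 (hs k)) y
        have hdist : ‖(WithLp.toLp 2 y : EuclideanSpace ℝ (Fin d)) -
            s k • siteToE (fun i => ⌊(s k)⁻¹ * y i⌋ : Site d)‖ ≤ Real.sqrt d := by
          refine (norm_toLp_sub_smul_siteToE_le (hs k) hy).trans ?_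
          have := Real.sqrt_nonneg (d : ℝ); nlinarith [hs1 k]
        calc |Ψ (s k • siteToE (fun i => ⌊(s k)⁻¹ * y i⌋ : Site d))|
            ≤ C * ((1 + ‖s k • siteToE (fun i => ⌊(s k)⁻¹ * y i⌋ : Site d)‖) ^ p)⁻¹ := hdom _
          _ ≤ C * ((1 + Real.sqrt d) ^ p * ((1 + ‖(WithLp.toLp 2 y : EuclideanSpace ℝ (Fin d))‖) ^ p)⁻¹) := by
              gcongr; exact inv_pow_le_of_norm_sub_le (Real.sqrt_nonneg d) hdist p
          _ ≤ C * ((1 + Real.sqrt d) ^ p * ((1 + ‖y‖) ^ p)⁻¹) := by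
              gcongr C * (_ * ?_)
              exact inv_anti₀ (by positivity)
                (pow_le_pow_left₀ (by positivity) (by linarith [pi_norm_le_norm_toLp y]) p)
          _ = C * (1 + Real.sqrt d) ^ p * ((1 + ‖y‖) ^ p)⁻¹ := by ring
      · rw [abs_zero]; exact mul_nonneg (mul_nonneg hC (by positivity)) (by positivity)
    · refine Filter.Eventually.of_forall fun y => ?_
      have hΨpt : Tendsto (fun k => Ψ (s k • siteToE (fun i => ⌊(s k)⁻¹ * y i⌋ : Site d))) atTop
          (𝓝 (f y)) := (hΨ.tendsto _).comp (tendsto_latticePoint s hs hs0 y)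
      refine hΨpt.congr' ?_
      filter_upwards [eventually_floor_mem_box s hs hs1 L hL y] with k hk
      rw [hF]; simp only; rw [cellStep_apply (hs k), if_pos hk]
  rw [← hJ]
  exact hlim.congr fun k => hI k

/-- **Continuum limit of lattice Riemann sums.**  For a continuous `Ψ : ℝ^d → ℝ` with polynomial decay
`|Ψ u| ≤ C (1 + ‖u‖)^{-p}`, `p > d`, spacings `s_k → 0⁺` and boxes with `s_k L_k → ∞`:
`s_k^d Σ_{x ∈ box d L_k} Ψ(s_k x) → ∫ Ψ`. -/
theorem tendsto_latticeRiemannSum {d : ℕ} (Ψ : EuclideanSpace ℝ (Fin d) → ℝ) (hΨ : Continuous Ψ)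
    {C : ℝ} {p : ℕ} (hp : d < p) (hdom : ∀ u, |Ψ u| ≤ C * ((1 + ‖u‖) ^ p)⁻¹)
    (s : ℕ → ℝ) (hs : ∀ k, 0 < s k) (hs0 : Tendsto s atTop (𝓝 0))
    (L : ℕ → ℕ) (hL : Tendsto (fun k => s k * L k) atTop atTop) :
    Tendsto (fun k => s k ^ d * ∑ x ∈ box d (L k), Ψ (s k • siteToE x)) atTop (𝓝 (∫ u, Ψ u)) := by
  obtain ⟨k₀, hk₀⟩ := (hs0.eventually (ge_mem_nhds zero_lt_one)).exists_forall_of_atTop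
  have h := tendsto_latticeRiemannSum_aux Ψ hΨ hp hdom (fun k => s (k + k₀)) (fun k => hs _)
    (fun k => hk₀ _ (Nat.le_add_left _ _)) ((tendsto_add_atTop_iff_nat k₀).2 hs0) (fun k => L (k + k₀))
    ((tendsto_add_atTop_iff_nat (f := fun k => s k * L k) k₀).2 hL)
  exact (tendsto_add_atTop_iff_nat (f := fun k => s k ^ d * ∑ x ∈ box d (L k), Ψ (s k • siteToE x)) k₀).1 h

/-! ### Part D: the pair version (double lattice sums) -/

/-- Evaluation of the pair cell step function. -/
private lemma cellStep₂_apply {d : ℕ} {s : ℝ} (hs : 0 < s) (B : Finset (Site d)) (c : Site d → Site d → ℝ)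
    (q : (Fin d → ℝ) × (Fin d → ℝ)) :
    ∑ xx ∈ B ×ˢ B, (FRD.cell s⁻¹ xx.1 ×ˢ FRD.cell s⁻¹ xx.2).indicator (fun _ => c xx.1 xx.2) q =
      if (fun i => ⌊s⁻¹ * q.1 i⌋) ∈ B ∧ (fun i => ⌊s⁻¹ * q.2 i⌋) ∈ B then
        c (fun i => ⌊s⁻¹ * q.1 i⌋) (fun i => ⌊s⁻¹ * q.2 i⌋) else 0 := by
  have hΛ : 0 < s⁻¹ := inv_pos.2 hs
  have hq : q ∈ FRD.cell s⁻¹ (fun i => ⌊s⁻¹ * q.1 i⌋) ×ˢ FRD.cell s⁻¹ (fun i => ⌊s⁻¹ * q.2 i⌋) :=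
    Set.mem_prod.2 ⟨FRD.mem_cell_floor hΛ q.1, FRD.mem_cell_floor hΛ q.2⟩
  have huniq : ∀ xx : Site d × Site d, q ∈ FRD.cell s⁻¹ xx.1 ×ˢ FRD.cell s⁻¹ xx.2 →
      xx = ((fun i => ⌊s⁻¹ * q.1 i⌋), (fun i => ⌊s⁻¹ * q.2 i⌋)) := by
    intro xx hxx
    obtain ⟨h1, h2⟩ := Set.mem_prod.1 hxx
    exact Prod.ext (FRD.eq_floor_of_mem_cell hΛ h1) (FRD.eq_floor_of_mem_cell hΛ h2)
  split_ifs with h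
  · have hmem : ((fun i => ⌊s⁻¹ * q.1 i⌋), (fun i => ⌊s⁻¹ * q.2 i⌋)) ∈ B ×ˢ B := Finset.mk_mem_product h.1 h.2
    rw [sum_eq_single_of_mem _ hmem (fun xx _ hxx => Set.indicator_of_notMem (fun hq' => hxx (huniq xx hq')) _),
      Set.indicator_of_mem hq]
  · refine sum_eq_zero fun xx hxx => Set.indicator_of_notMem (fun hq' => h ?_) _
    rw [huniq xx hq'] at hxx
    exact Finset.mem_product.1 hxx

/-- The integral of the pair cell step function is the normalised double lattice sum. -/
private lemma integral_cellStep₂ {d : ℕ} {s : ℝ} (hs : 0 < s) (B : Finset (Site d)) (c : Site d → Site d → ℝ) :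
    ∫ q : (Fin d → ℝ) × (Fin d → ℝ), ∑ xx ∈ B ×ˢ B,
        (FRD.cell s⁻¹ xx.1 ×ˢ FRD.cell s⁻¹ xx.2).indicator (fun _ => c xx.1 xx.2) q =
      (s ^ d) ^ 2 * ∑ x ∈ B, ∑ x' ∈ B, c x x' := by
  have hΛ : 0 < s⁻¹ := inv_pos.2 hs
  have hmeas : ∀ xx : Site d × Site d, MeasurableSet (FRD.cell s⁻¹ xx.1 ×ˢ FRD.cell s⁻¹ xx.2) :=
    fun xx => (FRD.measurableSet_cell _ _).prod (FRD.measurableSet_cell _ _)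
  have hvol : ∀ xx : Site d × Site d,
      (volume : Measure ((Fin d → ℝ) × (Fin d → ℝ))) (FRD.cell s⁻¹ xx.1 ×ˢ FRD.cell s⁻¹ xx.2) =
        ENNReal.ofReal ((s⁻¹ ^ d)⁻¹) * ENNReal.ofReal ((s⁻¹ ^ d)⁻¹) := by
    intro xx
    rw [Measure.volume_eq_prod, Measure.prod_prod, FRD.volume_cell hΛ, FRD.volume_cell hΛ]
  have hint : ∀ xx ∈ B ×ˢ B, Integrable ((FRD.cell s⁻¹ xx.1 ×ˢ FRD.cell s⁻¹ xx.2).indicator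
      (fun _ : (Fin d → ℝ) × (Fin d → ℝ) => c xx.1 xx.2)) := by
    intro xx _
    refine (integrableOn_const ?_).integrable_indicator (hmeas xx)
    rw [hvol]; exact ENNReal.mul_ne_top ENNReal.ofReal_ne_top ENNReal.ofReal_ne_top
  rw [integral_finsetSum _ hint, Finset.sum_product, mul_sum]
  refine sum_congr rfl fun x _ => ?_
  rw [mul_sum]
  refine sum_congr rfl fun x' _ => ?_
  rw [integral_indicator_const _ (hmeas (x, x')), smul_eq_mul, measureReal_def, hvol,
    ENNReal.toReal_mul, ENNReal.toReal_ofReal (by positivity), inv_pow, inv_inv]; ring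

/-- Dominated-convergence core for double sums (all spacings `≤ 1`). -/
private lemma tendsto_latticeRiemannSum₂_aux {d : ℕ}
    (Ψ : EuclideanSpace ℝ (Fin d) → EuclideanSpace ℝ (Fin d) → ℝ)
    (hΨ : Continuous fun z : EuclideanSpace ℝ (Fin d) × EuclideanSpace ℝ (Fin d) => Ψ z.1 z.2)
    {C : ℝ} {p : ℕ} (hp : d < p) (hdom : ∀ u v, |Ψ u v| ≤ C * ((1 + ‖u‖) ^ p)⁻¹ * ((1 + ‖v‖) ^ p)⁻¹)
    (s : ℕ → ℝ) (hs : ∀ k, 0 < s k) (hs1 : ∀ k, s k ≤ 1) (hs0 : Tendsto s atTop (𝓝 0))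
    (L : ℕ → ℕ) (hL : Tendsto (fun k => s k * L k) atTop atTop) :
    Tendsto (fun k => (s k ^ d) ^ 2 *
        ∑ x ∈ box d (L k), ∑ x' ∈ box d (L k), Ψ (s k • siteToE x) (s k • siteToE x')) atTop
      (𝓝 (∫ z : EuclideanSpace ℝ (Fin d) × EuclideanSpace ℝ (Fin d), Ψ z.1 z.2)) := by
  have hC : 0 ≤ C := by
    have h := hdom 0 0; simp only [norm_zero, add_zero, one_pow, inv_one, mul_one] at h; exact (abs_nonneg _).trans h
  set F : ℕ → (Fin d → ℝ) × (Fin d → ℝ) → ℝ := fun k q =>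
    ∑ xx ∈ box d (L k) ×ˢ box d (L k), (FRD.cell (s k)⁻¹ xx.1 ×ˢ FRD.cell (s k)⁻¹ xx.2).indicator
      (fun _ => Ψ (s k • siteToE xx.1) (s k • siteToE xx.2)) q with hF
  set f : (Fin d → ℝ) × (Fin d → ℝ) → ℝ := fun q => Ψ (WithLp.toLp 2 q.1) (WithLp.toLp 2 q.2) with hf
  -- (1) integrals of the step functions
  have hI : ∀ k, ∫ q, F k q = (s k ^ d) ^ 2 *
      ∑ x ∈ box d (L k), ∑ x' ∈ box d (L k), Ψ (s k • siteToE x) (s k • siteToE x') := fun k =>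
    integral_cellStep₂ (hs k) (box d (L k)) (fun x x' => Ψ (s k • siteToE x) (s k • siteToE x'))
  -- (2) the limit integral, transported to `E × E`
  have hmp : MeasurePreserving (⇑(MeasurableEquiv.toLp 2 (Fin d → ℝ))) volume volume := by
    rw [MeasurableEquiv.coe_toLp]; exact PiLp.volume_preserving_toLp (Fin d)
  have hmp₂ : MeasurePreserving
      (⇑(MeasurableEquiv.prodCongr (MeasurableEquiv.toLp 2 (Fin d → ℝ)) (MeasurableEquiv.toLp 2 (Fin d → ℝ))))
      volume volume := by
    have h := hmp.prod hmp
    rw [← Measure.volume_eq_prod, ← Measure.volume_eq_prod] at h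
    exact h
  have hco : ∀ q : (Fin d → ℝ) × (Fin d → ℝ),
      (MeasurableEquiv.prodCongr (MeasurableEquiv.toLp 2 (Fin d → ℝ)) (MeasurableEquiv.toLp 2 (Fin d → ℝ))) q =
        ((WithLp.toLp 2 q.1 : EuclideanSpace ℝ (Fin d)), (WithLp.toLp 2 q.2 : EuclideanSpace ℝ (Fin d))) :=
    fun q => rfl
  have hJ : ∫ q, f q = ∫ z : EuclideanSpace ℝ (Fin d) × EuclideanSpace ℝ (Fin d), Ψ z.1 z.2 := by
    have h := hmp₂.integral_comp' (g := fun z : EuclideanSpace ℝ (Fin d) × EuclideanSpace ℝ (Fin d) => Ψ z.1 z.2)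
    simp only [hco] at h
    simpa [hf] using h
  -- (3) dominated convergence
  have hfr : (Module.finrank ℝ (Fin d → ℝ) : ℝ) < (p : ℝ) := by
    rw [Module.finrank_fintype_fun_eq_card, Fintype.card_fin]; exact_mod_cast hp
  have hlim : Tendsto (fun k => ∫ q, F k q) atTop (𝓝 (∫ q, f q)) := by
    refine tendsto_integral_of_dominated_convergence
      (fun q => C * ((1 + Real.sqrt d) ^ p * (1 + Real.sqrt d) ^ p) *
        (((1 + ‖q.1‖) ^ p)⁻¹ * ((1 + ‖q.2‖) ^ p)⁻¹)) ?_ ?_ ?_ ?_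
    · intro k
      show AEStronglyMeasurable (fun q => ∑ xx ∈ box d (L k) ×ˢ box d (L k),
        (FRD.cell (s k)⁻¹ xx.1 ×ˢ FRD.cell (s k)⁻¹ xx.2).indicator
          (fun _ => Ψ (s k • siteToE xx.1) (s k • siteToE xx.2)) q) volume
      exact Finset.aestronglyMeasurable_fun_sum _ fun xx _ =>
        (aestronglyMeasurable_const (b := Ψ (s k • siteToE xx.1) (s k • siteToE xx.2))).indicator
          ((FRD.measurableSet_cell _ _).prod (FRD.measurableSet_cell _ _))
    · have h1 := integrable_one_add_norm (E := Fin d → ℝ) (μ := volume) hfr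
      have h := (h1.mul_prod h1).const_mul (C * ((1 + Real.sqrt d) ^ p * (1 + Real.sqrt d) ^ p))
      rw [← Measure.volume_eq_prod] at h
      refine h.congr (Filter.Eventually.of_forall fun q => ?_)
      simp only
      rw [Real.rpow_neg (by positivity), Real.rpow_natCast, Real.rpow_neg (by positivity), Real.rpow_natCast]
    · intro k
      refine Filter.Eventually.of_forall fun q => ?_
      rw [Real.norm_eq_abs, hF]
      simp only
      rw [cellStep₂_apply (hs k) (box d (L k)) (fun x x' => Ψ (s k • siteToE x) (s k • siteToE x'))]
      split_ifs with hmem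
      · have hd1 : ‖(WithLp.toLp 2 q.1 : EuclideanSpace ℝ (Fin d)) -
            s k • siteToE (fun i => ⌊(s k)⁻¹ * q.1 i⌋ : Site d)‖ ≤ Real.sqrt d := by
          refine (norm_toLp_sub_smul_siteToE_le (hs k) (FRD.mem_cell_floor (inv_pos.2 (hs k)) q.1)).trans ?_
          have := Real.sqrt_nonneg (d : ℝ); nlinarith [hs1 k]
        have hd2 : ‖(WithLp.toLp 2 q.2 : EuclideanSpace ℝ (Fin d)) -
            s k • siteToE (fun i => ⌊(s k)⁻¹ * q.2 i⌋ : Site d)‖ ≤ Real.sqrt d := by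
          refine (norm_toLp_sub_smul_siteToE_le (hs k) (FRD.mem_cell_floor (inv_pos.2 (hs k)) q.2)).trans ?_
          have := Real.sqrt_nonneg (d : ℝ); nlinarith [hs1 k]
        have hw1 : ((1 + ‖s k • siteToE (fun i => ⌊(s k)⁻¹ * q.1 i⌋ : Site d)‖) ^ p)⁻¹ ≤
            (1 + Real.sqrt d) ^ p * ((1 + ‖q.1‖) ^ p)⁻¹ :=
          (inv_pow_le_of_norm_sub_le (Real.sqrt_nonneg d) hd1 p).trans (by
            exact mul_le_mul_of_nonneg_left (inv_anti₀ (by positivity)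
              (pow_le_pow_left₀ (by positivity) (by linarith [pi_norm_le_norm_toLp q.1]) p)) (by positivity))
        have hw2 : ((1 + ‖s k • siteToE (fun i => ⌊(s k)⁻¹ * q.2 i⌋ : Site d)‖) ^ p)⁻¹ ≤
            (1 + Real.sqrt d) ^ p * ((1 + ‖q.2‖) ^ p)⁻¹ :=
          (inv_pow_le_of_norm_sub_le (Real.sqrt_nonneg d) hd2 p).trans (by
            exact mul_le_mul_of_nonneg_left (inv_anti₀ (by positivity)
              (pow_le_pow_left₀ (by positivity) (by linarith [pi_norm_le_norm_toLp q.2]) p)) (by positivity))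
        calc |Ψ (s k • siteToE (fun i => ⌊(s k)⁻¹ * q.1 i⌋ : Site d))
              (s k • siteToE (fun i => ⌊(s k)⁻¹ * q.2 i⌋ : Site d))|
            ≤ C * ((1 + ‖s k • siteToE (fun i => ⌊(s k)⁻¹ * q.1 i⌋ : Site d)‖) ^ p)⁻¹ *
                ((1 + ‖s k • siteToE (fun i => ⌊(s k)⁻¹ * q.2 i⌋ : Site d)‖) ^ p)⁻¹ := hdom _ _
          _ ≤ C * ((1 + Real.sqrt d) ^ p * ((1 + ‖q.1‖) ^ p)⁻¹) *
                ((1 + Real.sqrt d) ^ p * ((1 + ‖q.2‖) ^ p)⁻¹) := by gcongr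
          _ = C * ((1 + Real.sqrt d) ^ p * (1 + Real.sqrt d) ^ p) *
                (((1 + ‖q.1‖) ^ p)⁻¹ * ((1 + ‖q.2‖) ^ p)⁻¹) := by ring
      · rw [abs_zero]; exact mul_nonneg (mul_nonneg hC (by positivity)) (by positivity)
    · refine Filter.Eventually.of_forall fun q => ?_
      have hΨpt : Tendsto (fun k => Ψ (s k • siteToE (fun i => ⌊(s k)⁻¹ * q.1 i⌋ : Site d))
          (s k • siteToE (fun i => ⌊(s k)⁻¹ * q.2 i⌋ : Site d))) atTop (𝓝 (f q)) :=
        (hΨ.tendsto _).comp ((tendsto_latticePoint s hs hs0 q.1).prodMk_nhds (tendsto_latticePoint s hs hs0 q.2))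
      refine hΨpt.congr' ?_
      filter_upwards [eventually_floor_mem_box s hs hs1 L hL q.1, eventually_floor_mem_box s hs hs1 L hL q.2]
        with k hk1 hk2
      rw [hF]; simp only; rw [cellStep₂_apply (hs k) (box d (L k)) (fun x x' => Ψ (s k • siteToE x) (s k • siteToE x')), if_pos ⟨hk1, hk2⟩]
  rw [← hJ]
  exact hlim.congr fun k => hI k

/-- **Continuum limit of double lattice Riemann sums.**  For `Ψ : ℝ^d × ℝ^d → ℝ` continuous with product
polynomial decay `|Ψ(u,v)| ≤ C (1+‖u‖)^{-p} (1+‖v‖)^{-p}`, `p > d`, spacings `s_k → 0⁺` and boxes with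
`s_k L_k → ∞`: `s_k^{2d} Σ_{x,x' ∈ box d L_k} Ψ(s_k x, s_k x') → ∫_{ℝ^d × ℝ^d} Ψ` (product Lebesgue measure).
This is the shape of NT's `Q2` (`d = 4`, `Ψ(u,v) = w₁(u) w₂(v) K(v-u)`). -/
theorem tendsto_latticeRiemannSum₂ {d : ℕ}
    (Ψ : EuclideanSpace ℝ (Fin d) → EuclideanSpace ℝ (Fin d) → ℝ)
    (hΨ : Continuous fun z : EuclideanSpace ℝ (Fin d) × EuclideanSpace ℝ (Fin d) => Ψ z.1 z.2)
    {C : ℝ} {p : ℕ} (hp : d < p) (hdom : ∀ u v, |Ψ u v| ≤ C * ((1 + ‖u‖) ^ p)⁻¹ * ((1 + ‖v‖) ^ p)⁻¹)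
    (s : ℕ → ℝ) (hs : ∀ k, 0 < s k) (hs0 : Tendsto s atTop (𝓝 0))
    (L : ℕ → ℕ) (hL : Tendsto (fun k => s k * L k) atTop atTop) :
    Tendsto (fun k => (s k ^ d) ^ 2 *
        ∑ x ∈ box d (L k), ∑ x' ∈ box d (L k), Ψ (s k • siteToE x) (s k • siteToE x')) atTop
      (𝓝 (∫ z : EuclideanSpace ℝ (Fin d) × EuclideanSpace ℝ (Fin d), Ψ z.1 z.2)) := by
  obtain ⟨k₀, hk₀⟩ := (hs0.eventually (ge_mem_nhds zero_lt_one)).exists_forall_of_atTop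
  have h := tendsto_latticeRiemannSum₂_aux Ψ hΨ hp hdom (fun k => s (k + k₀)) (fun k => hs _)
    (fun k => hk₀ _ (Nat.le_add_left _ _)) ((tendsto_add_atTop_iff_nat k₀).2 hs0) (fun k => L (k + k₀))
    ((tendsto_add_atTop_iff_nat (f := fun k => s k * L k) k₀).2 hL)
  exact (tendsto_add_atTop_iff_nat (f := fun k => (s k ^ d) ^ 2 *
    ∑ x ∈ box d (L k), ∑ x' ∈ box d (L k), Ψ (s k • siteToE x) (s k • siteToE x')) k₀).1 h

end Summit.QuantumFields.YangMills.Cruxes.UniversalDetectorLimitExtraction
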